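import Summits.HodgeConjecture.HodgeConjecture.Theses.LimitExtension
import Literature.NumberTheory.Transcendental.Analytification
import Literature.AlgebraicGeometry.HodgeTheory.ClassesSupportedOn
import Literature.AlgebraicGeometry.HodgeTheory.GysinFormalismPushforward
import Literature.AlgebraicGeometry.Motives.AbstractHodgeTate

/-!
# Route LimitExtension — `SpecialisationOfAlgebraicity` (item stmt-HodgeConjecture-2998): coniveau-1 bookkeeping

Helper lemmas for the support item `SpecialisationOfAlgebraicity`: the last step of its proof
("hence `g^* B₀ − cl_X(Z_X) ∈ ker (H^{2k}(X) → H^{2k}(X ∖ g⁻¹E')) ⊆ N¹`") is the purely formal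
statement that a class on the smooth projective (irreducible) `X` whose pull-back along an open
immersion `j : V ⟶ X` dies off a proper Zariski-closed `Z ⊊ V` lies in
`supportedClasses X i 1 = N¹ Hⁱ(X(ℂ); ℂ)`: it dies on the complex points of the non-empty Zariski-open
`j(V ∖ Z) ⊆ X`, whose closed complement misses the generic point.  The point-set input is the
tree's proved `AlgPoints.isOpenEmbedding_map_holds` / `AlgPoints.range_map_of_isOpenImmersion_holds`
(`j(ℂ) : V(ℂ) ↪ X(ℂ)` is an open embedding with image `{P | pt P ∈ j(V)}`).
-/

noncomputable section

-- `Summit.HodgeConjecture.HodgeConjecture.Theorems` is the mandated namespace (single-conjunct summit: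
-- Sub = Summit), which `linter.dupNamespace` flags on every declaration; the lakefile turns the
-- linter off tree-wide (weak option), restated here so stand-alone elaboration is warning-free too.
set_option linter.dupNamespace false

open CategoryTheory AlgebraicGeometry Topology
open Literature.AlgebraicGeometry Literature.AlgebraicGeometry.Motives
open Literature.AlgebraicGeometry.HodgeTheory Literature.AlgebraicTopology.SingularHomology

namespace Summit.HodgeConjecture.HodgeConjecture.Theorems

variable {X V : SchemeOver ℂ}

/-- For an open immersion `j : V ⟶ X` of `ℂ`-schemes, a complex point of `X` whose underlying point
lies in `j(V ∖ Z)` lifts to a complex point of `V` off `Z` (a morphism `Spec ℂ → X` landing in the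
open `j(V)` factors uniquely through `j`). [cite: SGA1, Exp. XII Thm. 1.1, proof a)] -/
theorem exists_map_eq_of_pt_mem_image (j : V ⟶ X) [IsOpenImmersion j.left] {Z : Set V.left}
    (P : complexPointsCompl X (j.left.base '' Zᶜ)ᶜ) :
    ∃ Q : complexPointsCompl V Z, AlgPoints.map j Q.1 = P.1 := by
  have hP : P.1.pt ∈ j.left.base '' Zᶜ := by simpa only [Set.mem_compl_iff, not_not] using P.2
  obtain ⟨v, hvZ, hv⟩ := hP
  have hrange : P.1 ∈ Set.range (AlgPoints.map (L := ℂ) j) := by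
    rw [AlgPoints.range_map_of_isOpenImmersion_holds j]
    exact ⟨v, hv⟩
  obtain ⟨Q, hQ⟩ := hrange
  refine ⟨⟨Q, fun hQZ ↦ hvZ ?_⟩, hQ⟩
  have h1 : j.left.base Q.pt = P.1.pt := by rw [← AlgPoints.pt_map, hQ]
  rw [← hv] at h1
  rwa [← j.left.isOpenEmbedding.injective h1]

/-- The inclusion `(X ∖ (X ∖ j(V ∖ Z)))(ℂ) ↪ X(ℂ)` of the complex points over the Zariski-open
`j(V ∖ Z)` factors continuously through `(V ∖ Z)(ℂ) ↪ V(ℂ)` followed by `j(ℂ)`: the lift is the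
inverse of the open embedding `j(ℂ) : V(ℂ) ↪ X(ℂ)` on its image
(`AlgPoints.isOpenEmbedding_map_holds`). [cite: SGA1, Exp. XII Prop. 3.1 (xi)] -/
theorem exists_val_eq_mapContinuous_comp (j : V ⟶ X) [IsOpenImmersion j.left] (Z : Set V.left) :
    ∃ ψ : C(complexPointsCompl X (j.left.base '' Zᶜ)ᶜ, complexPointsCompl V Z),
      (⟨Subtype.val, continuous_subtype_val⟩ :
          C(complexPointsCompl X (j.left.base '' Zᶜ)ᶜ, ComplexPoints X)) =
        (AlgPoints.mapContinuous (L := ℂ) j).comp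
          ((⟨Subtype.val, continuous_subtype_val⟩ : C(complexPointsCompl V Z, ComplexPoints V)).comp
            ψ) := by
  -- the homeomorphism `V(ℂ) ≃ₜ j(ℂ)(V(ℂ))` of the open embedding `j(ℂ)`
  set e := (AlgPoints.isOpenEmbedding_map_holds (L := ℂ) j).isEmbedding.toHomeomorph with he
  have hmem : ∀ P : complexPointsCompl X (j.left.base '' Zᶜ)ᶜ,
      P.1 ∈ Set.range (AlgPoints.map (L := ℂ) j) := fun P ↦ by
    obtain ⟨Q, hQ⟩ := exists_map_eq_of_pt_mem_image j P
    exact ⟨Q.1, hQ⟩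
  -- the lift of `P` is the unique complex point `Q` of `V` off `Z` with `j(ℂ) Q = P`
  have hlift : ∀ P : complexPointsCompl X (j.left.base '' Zᶜ)ᶜ,
      AlgPoints.map j (e.symm ⟨P.1, hmem P⟩) = P.1 ∧ (e.symm ⟨P.1, hmem P⟩).pt ∉ Z := fun P ↦ by
    obtain ⟨Q, hQ⟩ := exists_map_eq_of_pt_mem_image j P
    have h : e.symm ⟨P.1, hmem P⟩ = Q.1 := by
      rw [Homeomorph.symm_apply_eq]
      ext : 1
      exact hQ.symm
    rw [h]
    exact ⟨hQ, Q.2⟩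
  refine ⟨⟨fun P ↦ ⟨e.symm ⟨P.1, hmem P⟩, (hlift P).2⟩, ?_⟩, ?_⟩
  · refine Continuous.subtype_mk ?_ _
    exact e.symm.continuous.comp (continuous_subtype_val.subtype_mk _)
  · ext P : 1
    exact ((hlift P).1).symm

/-- Restriction of `Hⁱ(X(ℂ); ℂ)` to the complex points over the Zariski-open `j(V ∖ Z)` kills every
class whose pull-back to `V` dies on `(V ∖ Z)(ℂ)` (it factors through pull-back to `V` and
restriction to `(V ∖ Z)(ℂ)`). [folklore] -/
theorem restrictCompl_image_compl_eq_zero (j : V ⟶ X) [IsOpenImmersion j.left] {Z : Set V.left}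
    {i : ℕ} {x : complexBetti X i}
    (hx : complexBetti.restrictCompl V Z i (complexBetti.map j i x) = 0) :
    complexBetti.restrictCompl X (j.left.base '' Zᶜ)ᶜ i x = 0 := by
  obtain ⟨ψ, hψ⟩ := exists_val_eq_mapContinuous_comp j Z
  rw [complexBetti.restrictCompl, hψ, singularCohomology.map_comp, singularCohomology.map_comp,
    ModuleCat.comp_apply, ModuleCat.comp_apply]
  change singularCohomology.map ℂ ℂ ψ i
      (complexBetti.restrictCompl V Z i (complexBetti.map j i x)) = 0
  rw [hx, map_zero]

/-- **Coniveau-1 bookkeeping.** Let `X` be smooth projective (hence irreducible), `j : V ⟶ X` an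
open immersion and `Z ⊊ V` a proper Zariski-closed subset.  A class `x ∈ Hⁱ(X(ℂ); ℂ)` whose
pull-back `j^* x` dies on `(V ∖ Z)(ℂ)` lies in `N¹ Hⁱ(X(ℂ); ℂ) = supportedClasses X i 1`: it dies on
the complex points over the non-empty Zariski-open `j(V ∖ Z)`, whose closed complement misses the
generic point of `X` and so has codimension `≥ 1` everywhere.
[cite: GrothendieckTopology1969, §1] -/
theorem mem_supportedClasses_one_of_restrictCompl_map_eq_zero {n i : ℕ}
    (hX : IsSmoothProjective n X) (j : V ⟶ X) [IsOpenImmersion j.left] {Z : Set V.left}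
    (hZ : IsClosed Z) (hZne : Z ≠ Set.univ) {x : complexBetti X i}
    (hx : complexBetti.restrictCompl V Z i (complexBetti.map j i x) = 0) :
    x ∈ supportedClasses X i 1 := by
  have hO : IsOpen (j.left.base '' Zᶜ) := j.left.isOpenEmbedding.isOpenMap _ hZ.isOpen_compl
  have hne : (j.left.base '' Zᶜ).Nonempty := by
    obtain ⟨v, hv⟩ := (Set.ne_univ_iff_exists_notMem Z).mp hZne
    exact ⟨j.left.base v, v, hv, rfl⟩
  refine mem_supportedClasses_of_restrictCompl_eq_zero hO.isClosed_compl (fun z hz ↦ ?_) ?_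
  · refine one_le_coheight_of_mem_of_isClosed hX hO.isClosed_compl (fun h ↦ ?_) hz
    obtain ⟨w, hw⟩ := hne
    have : w ∈ (j.left.base '' Zᶜ)ᶜ := h ▸ Set.mem_univ w
    exact this hw
  · exact restrictCompl_image_compl_eq_zero j hx


/-- In an irreducible `ℂ`-scheme `V`, a class in `Nʳ Hⁱ(V(ℂ); ℂ) = supportedClasses V i r` with
`r ≥ 1` dies off a single proper Zariski-closed subset: a member of the span is a finite sum of
classes dying off closed subsets `Z₁, …, Z_m` of codimension `≥ r ≥ 1`, hence dies off the closed
`Z₁ ∪ ⋯ ∪ Z_m`, which misses the generic point. [cite: GrothendieckTopology1969, §1] -/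
theorem exists_isClosed_ne_univ_restrictCompl_eq_zero [IrreducibleSpace V.left] {i r : ℕ}
    (hr : 0 < r) {y : complexBetti V i} (hy : y ∈ supportedClasses V i r) :
    ∃ Z : Set V.left, IsClosed Z ∧ Z ≠ Set.univ ∧ complexBetti.restrictCompl V Z i y = 0 := by
  -- the classes dying off some proper closed subset form a submodule `S`
  let S : Submodule ℂ (complexBetti V i) :=
    { carrier := {y | ∃ Z : Set V.left, IsClosed Z ∧ Z ≠ Set.univ ∧
        complexBetti.restrictCompl V Z i y = 0}
      add_mem' := by
        rintro a b ⟨Z₁, hZ₁, hZ₁ne, ha⟩ ⟨Z₂, hZ₂, hZ₂ne, hb⟩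
        refine ⟨Z₁ ∪ Z₂, hZ₁.union hZ₂, fun h ↦ ?_, ?_⟩
        · rcases isPreirreducible_iff_isClosed_union_isClosed.mp
            (PreirreducibleSpace.isPreirreducible_univ (X := V.left)) Z₁ Z₂ hZ₁ hZ₂ h.symm.subset
            with h₁ | h₂
          · exact hZ₁ne (Set.eq_univ_of_univ_subset h₁)
          · exact hZ₂ne (Set.eq_univ_of_univ_subset h₂)
        · have ha' : a ∈ classesSupportedOn V (Z₁ ∪ Z₂) i :=
            classesSupportedOn_mono Set.subset_union_left i (mem_classesSupportedOn_iff.mpr ha)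
          have hb' : b ∈ classesSupportedOn V (Z₁ ∪ Z₂) i :=
            classesSupportedOn_mono Set.subset_union_right i (mem_classesSupportedOn_iff.mpr hb)
          exact mem_classesSupportedOn_iff.mp (Submodule.add_mem _ ha' hb')
      zero_mem' := ⟨∅, isClosed_empty, fun h ↦ (Set.empty_ne_univ h).elim, map_zero _⟩
      smul_mem' := by
        rintro c a ⟨Z, hZ, hZne, ha⟩
        exact ⟨Z, hZ, hZne, by rw [map_smul, ha, smul_zero]⟩ }
  suffices h : supportedClasses V i r ≤ S from h hy
  refine classesSupportedOn_le_supportedClasses_iff.mpr fun Z hZ hZr z hz ↦ ⟨Z, hZ, fun hZu ↦ ?_, ?_⟩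
  · -- a closed subset of codimension `≥ r ≥ 1` everywhere misses the generic point
    have h0 : Order.coheight (genericPoint V.left) = 0 :=
      coheight_eq_zero_of_isGenericPoint_univ (genericPoint_spec V.left)
    have h1 := hZr (genericPoint V.left) (hZu ▸ Set.mem_univ _)
    rw [h0, nonpos_iff_eq_zero, Nat.cast_eq_zero] at h1
    exact hr.ne' h1
  · exact mem_classesSupportedOn_iff.mp hz

/-- **Reduction of item stmt-HodgeConjecture-2998 to its open-piece core.** The support item
`SpecialisationOfAlgebraicity` of route `LimitExtension` follows from the following CORE statement,
in which the smooth projective `X` with its morphism `g : X → W_{t₀}` (an open immersion on a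
non-empty open `U ⊆ X`) is replaced by an honest open immersion `j : V → W_{t₀}` from a smooth
irreducible `V` (intended: `V = U`, `j = g|_U`), and the conclusion "`∈ N¹ H^{2k}(X)`" by the sharper
"`j^* B₀ ∈ Nᵏ H^{2k}(V(ℂ); ℂ) = supportedClasses V (2k) k`" (the specialised cycle `𝒵₀ ∩ j(V)` has
codimension `k` in `V`).  The reduction is the formal coniveau bookkeeping: take `V = U ⊆ X`,
`j = g|_U`; a class of `Nᵏ H^{2k}(U)` (`k ≥ 1`) dies off a proper closed `Z ⊊ U`
(`exists_isClosed_ne_univ_restrictCompl_eq_zero`), so `(g ≫ ι)^* B` dies on the complex points of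
the non-empty Zariski-open `U ∖ Z ⊆ X` and lies in `N¹`
(`mem_supportedClasses_one_of_restrictCompl_map_eq_zero`).  What remains (the hypothesis `core`)
is exactly the classical specialisation-of-algebraicity argument: relative Hilbert/Chow schemes
and a finite base change spread `B_t` (`t ≠ t₀`) to a cycle flat over the curve, the tube
retraction `W_Δ ≃ W_{t₀}` specialises its class onto the special fibre with support in the
specialised cycle, and Poincaré duality on the smooth open piece `j(V)` (of multiplicity one,
meeting no other component) converts "capped class supported on `𝒵₀`" into "dies off `𝒵₀`".
[cite: Fulton1998, §10.1, §19.1 and §20.3] -/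
theorem specialisationOfAlgebraicity_of_core
    (core : ∀ ⦃k : ℕ⦄ ⦃V T W : SchemeOver ℂ⦄ (f : W ⟶ T) (t₀ : ComplexPoints T)
      (j : V ⟶ fiberOver f t₀) (B : complexBetti W (2 * k)),
      SmoothOfRelativeDimension (2 * k) V.hom → IrreducibleSpace V.left →
      SmoothOfRelativeDimension 1 T.hom → IrreducibleSpace T.left → Flat f.left →
      IsProper f.left → IsOpenImmersion j.left →
      (∀ t : ComplexPoints T, t ≠ t₀ → IsSmoothProjective (2 * k) (fiberOver f t) ∧
        complexBetti.map (fiberι f t) (2 * k) B ∈ algebraicClasses (fiberOver f t) k) →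
      complexBetti.map (j ≫ fiberι f t₀) (2 * k) B ∈ supportedClasses V (2 * k) k) :
    Summit.HodgeConjecture.HodgeConjecture.Theses.LimitExtension.SpecialisationOfAlgebraicity := by
  unfold Summit.HodgeConjecture.HodgeConjecture.Theses.LimitExtension.SpecialisationOfAlgebraicity
  intro k X T W f t₀ g B hk hX hT hTirr hflat hprop hU hfib
  obtain ⟨U, hUne, hUg⟩ := hU
  haveI : IrreducibleSpace X.left := hX.irreducibleSpace
  -- the open piece `U ⊆ X` as a `ℂ`-scheme, its inclusion `jU` and `j = g|_U`
  let V : SchemeOver ℂ := Over.mk (U.ι ≫ X.hom)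
  let jU : V ⟶ X := Over.homMk U.ι rfl
  let j : V ⟶ fiberOver f t₀ := jU ≫ g
  have hj : IsOpenImmersion j.left := hUg
  haveI hjU : IsOpenImmersion jU.left := inferInstanceAs (IsOpenImmersion U.ι)
  have hVirr : IrreducibleSpace V.left := by
    haveI : Nonempty U := hUne.to_subtype
    exact isIrreducible_iff_irreducibleSpace.mp
      ⟨hUne, (PreirreducibleSpace.isPreirreducible_univ (X := X.left)).open_subset U.isOpen
        (Set.subset_univ _)⟩
  have hVsm : SmoothOfRelativeDimension (2 * k) V.hom := by
    haveI := hX.smoothOfRelativeDimension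
    have h : SmoothOfRelativeDimension (0 + 2 * k) (U.ι ≫ X.hom) := inferInstance
    rwa [Nat.zero_add] at h
  have hcore := core f t₀ j B hVsm hVirr hT hTirr hflat hprop hj hfib
  have hcomp : complexBetti.map (j ≫ fiberι f t₀) (2 * k) B =
      complexBetti.map jU (2 * k) (complexBetti.map (g ≫ fiberι f t₀) (2 * k) B) := by
    rw [show j ≫ fiberι f t₀ = jU ≫ (g ≫ fiberι f t₀) from Category.assoc _ _ _,
      complexBetti.map_comp, ModuleCat.comp_apply]
  rw [hcomp] at hcore
  obtain ⟨Z, hZ, hZne, h0⟩ := exists_isClosed_ne_univ_restrictCompl_eq_zero (V := V) hk hcore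
  exact mem_supportedClasses_one_of_restrictCompl_map_eq_zero hX jU hZ hZne h0

/-- **Refined reduction: item stmt-HodgeConjecture-2998 ⇐ SPREAD ∧ LIMIT.** The open-piece core of
`specialisationOfAlgebraicity_of_core` splits into the two classical ingredients, typed on the tree's
carriers with SUPPORTS in place of cycles:

* `spread` — **spreading of algebraic supports along the family** (relative Hilbert/Chow schemes,
  countability, flat limits of supports over the smooth curve; Voisin II §3.3.1, §7.3.2; Fulton 1998
  §10.1): if `B_t` is an algebraic class on the smooth projective `2k`-fold `W_t` for every `t ≠ t₀`,
  there is ONE Zariski-closed `𝒵 ⊆ W` off whose slices `𝒵_t` all these `B_t` die, and whose slice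
  over `t₀` has codimension `≥ k` in the special fibre (flat limits of `k`-dimensional supports are
  `k`-dimensional);
* `limit` — **upper semicontinuity of supports at the degeneration, smooth-locus form** (Ehresmann
  near compact subsets of the smooth open piece `j(V)` of the special fibre, vanishing detected on
  compacta up to homotopy): if `B_t` dies off `𝒵_t` for all `t ≠ t₀` then `j^* B₀` dies off
  `j⁻¹(𝒵_{t₀})`.

Given both, `j^* B₀` dies off the closed `Z₀ = j⁻¹(𝒵_{t₀})`, all of whose points have codimension
`≥ k` in `V` (codimension is preserved by the open immersion `j`, Mathlib
`coheight_eq_of_isOpenImmersion`), so `j^* B₀ ∈ Nᵏ H^{2k}(V(ℂ); ℂ)` — the `core` — and the item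
follows by `specialisationOfAlgebraicity_of_core`. [cite: Fulton1998, §10.1, §19.1 and §20.3]
[cite: VoisinHodgeII2003, §3.3.1 and §7.3.2] -/
theorem specialisationOfAlgebraicity_of_spread_of_limit
    (spread : ∀ ⦃k : ℕ⦄ ⦃T W : SchemeOver ℂ⦄ (f : W ⟶ T) (t₀ : ComplexPoints T)
      (B : complexBetti W (2 * k)),
      SmoothOfRelativeDimension 1 T.hom → IrreducibleSpace T.left → Flat f.left →
      IsProper f.left →
      (∀ t : ComplexPoints T, t ≠ t₀ → IsSmoothProjective (2 * k) (fiberOver f t) ∧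
        complexBetti.map (fiberι f t) (2 * k) B ∈ algebraicClasses (fiberOver f t) k) →
      ∃ 𝒵 : Set W.left, IsClosed 𝒵 ∧
        (∀ m : ↥(fiberOver f t₀).left, (fiberι f t₀).left.base m ∈ 𝒵 →
          (k : ℕ∞) ≤ Order.coheight m) ∧
        ∀ t : ComplexPoints T, t ≠ t₀ →
          complexBetti.restrictCompl (fiberOver f t) ((fiberι f t).left.base ⁻¹' 𝒵) (2 * k)
            (complexBetti.map (fiberι f t) (2 * k) B) = 0)
    (limit : ∀ ⦃i n : ℕ⦄ ⦃V T W : SchemeOver ℂ⦄ (f : W ⟶ T) (t₀ : ComplexPoints T)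
      (j : V ⟶ fiberOver f t₀) (𝒵 : Set W.left) (B : complexBetti W i),
      SmoothOfRelativeDimension n V.hom → SmoothOfRelativeDimension 1 T.hom →
      IrreducibleSpace T.left → Flat f.left → IsProper f.left → IsOpenImmersion j.left →
      IsClosed 𝒵 →
      (∀ t : ComplexPoints T, t ≠ t₀ →
        complexBetti.restrictCompl (fiberOver f t) ((fiberι f t).left.base ⁻¹' 𝒵) i
          (complexBetti.map (fiberι f t) i B) = 0) →
      complexBetti.restrictCompl V ((j ≫ fiberι f t₀).left.base ⁻¹' 𝒵) i
        (complexBetti.map (j ≫ fiberι f t₀) i B) = 0) :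
    Summit.HodgeConjecture.HodgeConjecture.Theses.LimitExtension.SpecialisationOfAlgebraicity := by
  refine specialisationOfAlgebraicity_of_core
    fun k V T W f t₀ j B hV _hVirr hT hTirr hflat hprop hj hfib ↦ ?_
  obtain ⟨𝒵, h𝒵, hcodim, hdies⟩ := spread f t₀ B hT hTirr hflat hprop hfib
  have h0 := limit f t₀ j 𝒵 B hV hT hTirr hflat hprop hj h𝒵 hdies
  -- `j^* B₀` dies off the closed `Z₀ = j⁻¹(𝒵_{t₀})`, of codimension `≥ k` in `V`
  refine mem_supportedClasses_of_restrictCompl_eq_zero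
    (h𝒵.preimage (j ≫ fiberι f t₀).left.base.hom.continuous) (fun z hz ↦ ?_) h0
  have hz' : (fiberι f t₀).left.base (j.left.base z) ∈ 𝒵 := by
    simpa only [Set.mem_preimage, Over.comp_left, Scheme.Hom.comp_base, TopCat.hom_comp,
      ContinuousMap.comp_apply] using hz
  have h := hcodim (j.left.base z) hz'
  rwa [coheight_eq_of_isOpenImmersion j.left] at h

end Summit.HodgeConjecture.HodgeConjecture.Theorems

end
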